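import Summits.ValiantsHypothesis.ValiantsHypothesis.Theorems.BarrierLeverAnchoredDoorHitsLowerPairsDTSStep

/-!
# Support item `AnchoredDoorHitsLowerPairs` (stmt-ValiantsHypothesis-22510), line `anchored-peeling`:
# the decomposing DT-stage as an INDUCTION STEP on lower pairs

Helper file (`--supports stmt-ValiantsHypothesis-22510`; cell valiant-natproofs, rung V4, 𝒟-side door (c); registered line
`Cruxes/AnchoredDoorHitsLowerPairs/Lines/anchored_peeling.lean` v10; prover seat val-np-p1 gen 18). One bookkeeping `def … : Prop`
(`DTPeel.DTSStepData`, the finite data of a decomposing DT-stage) and the induction step. Closes NO item; asserts NO conjecture.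

* `DTPeel.DTSStepData u w` — the `x`-side data of a DECOMPOSING DT-STAGE of the layout `(u, w)` (memo
  HOME/val-np-p1/g18/DTS-MEMO-valnp1-g18.md): a used vertex `a`, a type list `(B_j, c_j, D_j)_{j<J}` (distinct anchors `c_j`, `a ∉ B_j`,
  `c_j ∉ D_j`), the first-fit class assignment on link rows, and the SIZE CONDITION «as many link rows of class `j` as columns whose first
  contained stamp is `E_j = {c_j} ⊔ D_j`». For lower families this is a sequence `(B_j ∈ L_j, E_j ∈ K_j ∖ {∅}, c_j ∈ E_j)` with
  `|↑B_j ∩ L_j| = |↑E_j ∩ K_j|`, `L_1 = lk_a R`, `K_1 = C`, `L_{j+1} = L_j ∖ ↑B_j`, `K_{j+1} = K_j ∖ ↑E_j`, exhausting `lk_a R`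
  (decidable in milliseconds per vertex, lab/dts3.py).
* `DTPeel.symbolicDet_ne_zero_of_dtsStepData` — **THE INDUCTION STEP**: if every injective LOWER pair with fewer than `r` rows has nonzero
  symbolic minor (profile `s ≥ 1`), then so has every injective lower pair with `r` rows that admits a decomposing DT-stage: the stage's
  deletion pair and shifted class pairs are injective lower pairs with fewer rows (`DTPeel.symbolicDet_ne_zero_of_dtsStep`, `…DTSStep`).
  USE: class theorems (a family of lower pairs closed under taking the sub-pairs of some decomposing stage satisfies U1 by induction on `r`),
  and recursive per-instance certificates. The star(1) step is the one-type case; P_n = (∂Δⁿ, Δⁿ⁻¹ ⊔ Δⁿ⁻¹) needs two types.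

WHAT THIS IS NOT: no claim that every lower pair admits such a stage (single-stage existence is OPEN and doubtful for the family
«complete graph versus cube», where the `x`-side provably has none); nothing on crux stmt-ValiantsHypothesis-14610 or on `VP` versus `VNP`.
-/

set_option linter.dupNamespace false

namespace Summit.ValiantsHypothesis.ValiantsHypothesis.Theorems.BarrierLever.AnchoredPeeling

open Finset MvPolynomial

noncomputable section

/-- The `x`-side data of a DECOMPOSING DT-STAGE of the layout `(u, w)`: a used vertex `a`, a type list `(B, c, D)` of length `J`
(distinct anchor columns, tails avoiding the vertex / the anchor), a first-fit class assignment `cls` on the link rows, and the size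
condition matching link rows of class `j` with the columns whose first contained stamp is `insert (c j) (D j)`. -/
def DTPeel.DTSStepData {h r : ℕ} (u w : Fin r → Finset (Fin h)) : Prop :=
  ∃ (a : Fin h) (J : ℕ) (B : Fin J → Finset (Fin h)) (c : Fin J → Fin h) (D : Fin J → Finset (Fin h)) (cls : Fin r → Fin J),
    (∃ i, a ∈ u i) ∧ Function.Injective c ∧ (∀ j, a ∉ B j) ∧ (∀ j, c j ∉ D j) ∧
    (∀ i, a ∈ u i → B (cls i) ⊆ (u i).erase a) ∧
    (∀ i, a ∈ u i → ∀ j, j < cls i → ¬ B j ⊆ (u i).erase a) ∧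
    (∀ j : Fin J, (univ.filter fun i => a ∈ u i ∧ cls i = j).card =
      (univ.filter fun k => insert (c j) (D j) ⊆ w k ∧ ∀ j', j' < j → ¬ insert (c j') (D j') ⊆ w k).card)

namespace DTPeel

variable {h : ℕ}

section Induction

variable {s r : ℕ}

/-- An injective enumeration has `r` distinct values. -/
private theorem card_image_univ' {u : Fin r → Finset (Fin h)} (hu : Function.Injective u) :
    (Finset.univ.image u).card = r := by
  classical
  rw [Finset.card_image_of_injective _ hu, Finset.card_univ, Fintype.card_fin]

/-- A sub-enumeration whose range injects into `Set.range u` and misses a member of it is strictly shorter. -/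
private theorem lt_of_range_inj {r' : ℕ} {u : Fin r → Finset (Fin h)} {u' : Fin r' → Finset (Fin h)}
    (hu : Function.Injective u) (g : Finset (Fin h) → Finset (Fin h))
    (hg : ∀ k k', g (u' k) = g (u' k') → k = k') (hmem : ∀ k, g (u' k) ∈ Set.range u)
    (Z : Finset (Fin h)) (hZ : Z ∈ Set.range u) (hmiss : ∀ k, g (u' k) ≠ Z) : r' < r := by
  classical
  have hss : Finset.univ.image (fun k => g (u' k)) ⊂ Finset.univ.image u := by
    rw [Finset.ssubset_iff_subset_ne]
    refine ⟨fun x hx => ?_, fun heq => ?_⟩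
    · obtain ⟨k, -, rfl⟩ := Finset.mem_image.mp hx
      obtain ⟨i, hi⟩ := hmem k
      exact Finset.mem_image.mpr ⟨i, Finset.mem_univ _, hi⟩
    · obtain ⟨i, hi⟩ := hZ
      have hZ' : Z ∈ Finset.univ.image (fun k => g (u' k)) := by
        rw [heq]; exact Finset.mem_image.mpr ⟨i, Finset.mem_univ _, hi⟩
      obtain ⟨k, -, hk⟩ := Finset.mem_image.mp hZ'
      exact hmiss k hk
  have hlt := Finset.card_lt_card hss
  have hinj : Function.Injective (fun k => g (u' k)) := fun k k' hkk => hg k k' hkk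
  rwa [card_image_univ' hinj, card_image_univ' hu] at hlt

/-- **One decomposing stage + the induction hypothesis below `r` ⟹ non-vanishing** (the sub-pairs of a lower pair are lower pairs
with fewer rows). -/
theorem symbolicDet_ne_zero_of_dtsStepData (hs : 1 ≤ s)
    (ih : ∀ r', r' < r → ∀ (u' w' : Fin r' → Finset (Fin h)), Function.Injective u' → Function.Injective w' →
      IsLowerSet (Set.range u') → IsLowerSet (Set.range w') → symbolicDet s h r' u' w' ≠ 0)
    (u w : Fin r → Finset (Fin h)) (hu : Function.Injective u) (hw : Function.Injective w)
    (hlu : IsLowerSet (Set.range u)) (hlw : IsLowerSet (Set.range w)) (hdata : DTSStepData u w) :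
    symbolicDet s h r u w ≠ 0 := by
  classical
  obtain ⟨a, J, B, c, D, cls, ⟨i₀, hi₀⟩, hc, haB, hcD, hcls, hmin, hcount⟩ := hdata
  have hr0 : 0 < r := Fin.pos i₀
  have hempty : (∅ : Finset (Fin h)) ∈ Set.range u := hlu (Finset.empty_subset (u i₀)) ⟨i₀, rfl⟩
  refine symbolicDet_ne_zero_of_dtsStep hs u w hu hw a B c D cls hc haB hcD hcls hmin hcount ?_ ?_
  · -- the deletion pair
    intro r₀ u₀ w₀ hu₀ hw₀ hru hrw
    have hmem : ∀ k, u₀ k ∈ Set.range u ∧ a ∉ u₀ k := fun k => by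
      have hk : u₀ k ∈ Set.range u₀ := ⟨k, rfl⟩
      rw [hru] at hk; exact hk
    refine ih r₀ ?_ u₀ w₀ hu₀ hw₀ ?_ ?_
    · refine lt_of_range_inj hu id (fun k k' hkk => hu₀ hkk) (fun k => (hmem k).1) (u i₀) ⟨i₀, rfl⟩ (fun k hk => ?_)
      have hk' : u₀ k = u i₀ := hk
      exact (hmem k).2 (hk'.symm ▸ hi₀)
    · rw [hru]
      intro S T hTS hS
      exact ⟨hlu hTS hS.1, fun haT => hS.2 (hTS haT)⟩
    · rw [hrw]
      intro S T hTS hS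
      exact ⟨hlw hTS hS.1, fun j hj => hS.2 j (hj.trans hTS)⟩
  · -- the shifted class pairs
    intro j r₁ u₁ w₁ hu₁ hw₁ hru hrw
    have hmem : ∀ k, a ∉ u₁ k ∧ Disjoint (u₁ k) (B j) ∧ insert a (u₁ k ∪ B j) ∈ Set.range u ∧
        ∀ j', j' < j → ¬ B j' ⊆ u₁ k ∪ B j := fun k => by
      have hk : u₁ k ∈ Set.range u₁ := ⟨k, rfl⟩
      rw [hru] at hk; exact hk
    refine ih r₁ ?_ u₁ w₁ hu₁ hw₁ ?_ ?_
    · refine lt_of_range_inj hu (fun S => insert a (S ∪ B j)) (fun k k' hkk => hu₁ ?_) (fun k => (hmem k).2.2.1)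
        ∅ hempty (fun k hk => Finset.notMem_empty a (hk ▸ Finset.mem_insert_self a _))
      have hk : a ∉ u₁ k ∪ B j := by rw [Finset.mem_union, not_or]; exact ⟨(hmem k).1, haB j⟩
      have hk' : a ∉ u₁ k' ∪ B j := by rw [Finset.mem_union, not_or]; exact ⟨(hmem k').1, haB j⟩
      have h1 := congrArg (fun S => (S.erase a) \ B j) hkk
      simp only [Finset.erase_insert hk, Finset.erase_insert hk', Finset.union_sdiff_cancel_right (hmem k).2.1,
        Finset.union_sdiff_cancel_right (hmem k').2.1] at h1
      exact h1
    · rw [hru]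
      intro S T hTS hS
      refine ⟨fun haT => hS.1 (hTS haT), Disjoint.mono_left hTS hS.2.1, ?_, fun j' hj' hB => hS.2.2.2 j' hj' ?_⟩
      · exact hlu (Finset.insert_subset_insert a (Finset.union_subset_union hTS subset_rfl)) hS.2.2.1
      · exact hB.trans (Finset.union_subset_union hTS subset_rfl)
    · rw [hrw]
      intro S T hTS hS
      refine ⟨Disjoint.mono_left hTS hS.1, ?_, fun j' hj' hE => hS.2.2 j' hj' ?_⟩
      · exact hlw (Finset.union_subset_union hTS subset_rfl) hS.2.1
      · exact hE.trans (Finset.union_subset_union hTS subset_rfl)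

end Induction

end DTPeel

end

end Summit.ValiantsHypothesis.ValiantsHypothesis.Theorems.BarrierLever.AnchoredPeeling
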